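import Summits.QuantumFields.BalabanUV.T4Continuum.Support.AveragingDeficitNearIdentity
import Summits.QuantumFields.BalabanUV.T4Continuum.Support.AveragingDeficitLatticeH2Prep
import Literature.MathematicalPhysics.QuantumFieldTheory.Balaban1983to89.Beta.TransportVertices
import HarnessLib

/-!
# AveragingDeficitPlaqList (T⁴ programme, node NE3, row NE3-R2, gen 4) — the plaquette list of a vector potential in a
# local exponential gauge: the plaquette variable as an ordered product of exponentials (`Beta.TransportVertices.holonomy`),
# its linearised flux, the second-difference identity, sizes, and the Lipschitz bound `‖quad l′ − quad l‖ ≤ n²·α·δ` for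
# the quadratic transport vertex

HONEST FRAMING (cell `pub-balaban`, T4-DAG PAGE 1; unit `b2b-balaban-t4-ne3r2-p1` = owner of BINDER-OWNERS row NE3-R2,
gen 4).  The cell's T4 target is the finite-torus continuum limit of the unit-scale averaged loop expectations — NOT
infinite volume, NO mass gap, NOT Clay, NOT summit progress.  Preparatory algebra for `AveragingDeficitFluxExpansion`
(the pointwise second-order expansion of the covariant flux gradient) in THE K-DATUM PROGRAMME of this gen: B11 Thm 1
prints sup bounds on the potential `A` of a local exponential gauge `U = e^{iηA}` per cube ((8), (10)); the NE3 energy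
route and row NE3's action sandwich consume `‖∇_U F‖_{ℓ²}`.

CONTENT (all [folklore], 0 sorry): §1 `plaqList a x μ ν = [a(x,μ), a(x+e_μ,ν), −a(x+e_ν,μ), −a(x,ν)]`, `sum_plaqList`
(= the linearised flux `a(x,μ) + a(x+e_μ,ν) − a(x+e_ν,μ) − a(x,ν)`), `sum_plaqList_eq_fd`, **`sum_plaqList_sub`** (the
difference of the linearised fluxes at `x + e_κ` and `x` IS `D_μD_κa_ν(x) − D_νD_κa_μ(x)`), **`fhol_eq_holonomy`** (in an
exponential gauge the plaquette variable `T4AveragingDeficitWall.fhol` IS `Beta.TransportVertices.holonomy (plaqList …)`,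
so the tree's second-order ordered-product expansion `norm_holonomy_sub_taylor_two_le` applies verbatim); §2
`size_plaqList_le` (`≤ 4α₀`), `norm_sum_plaqList_le` (`≤ 2α₁`); §3 `Close α δ l l′` (same length, entries `≤ α`, entrywise
differences `≤ δ`), `Close.size_le`, `Close.norm_sum_sub_le`, **`Close.norm_quad_sub_le`** (`‖quad l′ − quad l‖ ≤ n²·α·δ`, by
induction on the recursion `quad (b :: l) = quad l + b·Σl + ½b²`), `l1_e`, `close_plaqList` (the plaquette lists at `x` and
`x + e_κ` are `(α₀, α₁)`-close under sup bounds on `a` and on its `κ`-differences).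
Context: T. Bałaban, Commun. Math. Phys. **102** (1985) 277–309 [Balaban1985Variational], Thm 1 (8)–(10) p. 279;
**99** (1985) 389–434 [Balaban1985BackgroundPropagators] (3.2)–(3.6) pp. 390–391 (second-order plaquette expansion; kernel
form `Beta.TransportVertices`).  No printed sentence is a hypothesis.  PLACEMENT: `Summits/QuantumFields/BalabanUV/`
(human rule 2026-08-19).  Record: HOME `t4/T4-EST-NE3-R2.md` v0.5.
-/

set_option autoImplicit false

open scoped BigOperators Matrix.Norms.L2Operator
open NormedSpace

namespace Summit.QuantumFields.BalabanUV.T4Continuum.AveragingDeficitPlaqList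

open Literature.MathematicalPhysics.QuantumFieldTheory.Balaban1983to89
open B7Prop1Explicit B7Prop2Explicit MatrixLog UnitaryModel
open T4AveragingDeficitWall hiding Site Plane Plaq Bond
open Beta.TransportVertices (holonomy quad size expTail holonomy_cons holonomy_nil quad_cons quad_nil size_cons size_nil
  size_nonneg norm_quad_le norm_sum_le_size)
open AveragingDeficitLatticeH2Prep (fd)

noncomputable section

variable {d : ℕ} {n : Type*} [Fintype n] [DecidableEq n]

local notation "𝕄" => Matrix n n ℂ
local notation "Site" => B7Prop1Explicit.Site

/-! ## §1 The plaquette list of a vector potential and its holonomy -/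

/-- The ordered list of (signed) potentials along the plaquette word at `x` in the plane `(μ, ν)`:
`[a(x,μ), a(x+e_μ,ν), −a(x+e_ν,μ), −a(x,ν)]`. [folklore] -/
def plaqList (a : Site d → Fin d → 𝕄) (x : Site d) (μ ν : Fin d) : List 𝕄 :=
  [a x μ, a (x + e μ) ν, -a (x + e ν) μ, -a x ν]

omit [Fintype n] [DecidableEq n] in
/-- The sum of the plaquette list is the linearised (abelian) flux `a(x,μ) + a(x+e_μ,ν) − a(x+e_ν,μ) − a(x,ν)`.
[folklore] -/
theorem sum_plaqList (a : Site d → Fin d → 𝕄) (x : Site d) (μ ν : Fin d) :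
    (plaqList a x μ ν).sum = a x μ + a (x + e μ) ν - a (x + e ν) μ - a x ν := by
  simp only [plaqList, List.sum_cons, List.sum_nil]
  abel

/-- The linearised flux as two first differences: `−D_ν a_μ(x) + D_μ a_ν(x)`. [folklore] -/
theorem sum_plaqList_eq_fd (a : Site d → Fin d → 𝕄) (x : Site d) (μ ν : Fin d) :
    (plaqList a x μ ν).sum = fd μ (fun z => a z ν) x - fd ν (fun z => a z μ) x := by
  rw [sum_plaqList]; simp only [fd]; abel

/-- THE SECOND-DIFFERENCE IDENTITY: the difference of the linearised fluxes at `x + e_κ` and `x` is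
`D_μD_κ a_ν(x) − D_νD_κ a_μ(x)`. [folklore] -/
theorem sum_plaqList_sub (a : Site d → Fin d → 𝕄) (x : Site d) (κ μ ν : Fin d) :
    (plaqList a (x + e κ) μ ν).sum - (plaqList a x μ ν).sum
      = fd μ (fd κ (fun z => a z ν)) x - fd ν (fd κ (fun z => a z μ)) x := by
  rw [sum_plaqList, sum_plaqList]
  simp only [fd, add_right_comm x (e μ) (e κ), add_right_comm x (e ν) (e κ)]
  abel

/-- In an exponential gauge the plaquette variable IS the ordered product of exponentials of the plaquette list.
[folklore] -/
theorem fhol_eq_holonomy {V : Site d → Fin d → 𝕄ˣ} {a : Site d → Fin d → 𝕄} {x : Site d} {μ ν : Fin d}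
    (h1 : ((V x μ : 𝕄ˣ) : 𝕄) = exp (a x μ)) (h2 : ((V (x + e μ) ν : 𝕄ˣ) : 𝕄) = exp (a (x + e μ) ν))
    (h3 : ((V (x + e ν) μ : 𝕄ˣ) : 𝕄) = exp (a (x + e ν) μ)) (h4 : ((V x ν : 𝕄ˣ) : 𝕄) = exp (a x ν))
    (hlt : μ < ν) :
    ((fhol V (x, ⟨(μ, ν), hlt⟩) : 𝕄ˣ) : 𝕄) = holonomy (plaqList a x μ ν) := by
  rw [fhol, val_hol_plaqWord, h1, h2, units_val_inv_eq_exp_neg h3, units_val_inv_eq_exp_neg h4]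
  simp only [plaqList, holonomy_cons, holonomy_nil, mul_one]

/-! ## §2 Sizes -/

/-- `size (plaqList) ≤ 4α₀` under a sup bound on the four potentials. [folklore] -/
theorem size_plaqList_le {a : Site d → Fin d → 𝕄} {x : Site d} {μ ν : Fin d} {α₀ : ℝ}
    (h1 : ‖a x μ‖ ≤ α₀) (h2 : ‖a (x + e μ) ν‖ ≤ α₀) (h3 : ‖a (x + e ν) μ‖ ≤ α₀) (h4 : ‖a x ν‖ ≤ α₀) :
    size (plaqList a x μ ν) ≤ 4 * α₀ := by
  simp only [plaqList, size_cons, size_nil, norm_neg]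
  linarith

/-- `‖Σ plaqList‖ ≤ 2α₁` under a bound on the two first differences that make up the linearised flux. [folklore] -/
theorem norm_sum_plaqList_le {a : Site d → Fin d → 𝕄} {x : Site d} {μ ν : Fin d} {α₁ : ℝ}
    (h1 : ‖fd μ (fun z => a z ν) x‖ ≤ α₁) (h2 : ‖fd ν (fun z => a z μ) x‖ ≤ α₁) :
    ‖(plaqList a x μ ν).sum‖ ≤ 2 * α₁ := by
  rw [sum_plaqList_eq_fd]
  exact (norm_sub_le _ _).trans (by linarith)

/-! ## §3 The quadratic transport vertex is Lipschitz: `‖quad l′ − quad l‖ ≤ n²·α·δ` -/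

section Quad

variable {𝔸 : Type*} [NormedRing 𝔸] [NormedAlgebra ℂ 𝔸]

/-- Entrywise closeness of two lists: same length, all entries of norm `≤ α`, entrywise differences `≤ δ`. [folklore] -/
@[folklore]
def Close (α δ : ℝ) : List 𝔸 → List 𝔸 → Prop :=
  List.Forall₂ fun b b' => ‖b‖ ≤ α ∧ ‖b'‖ ≤ α ∧ ‖b' - b‖ ≤ δ

omit [NormedAlgebra ℂ 𝔸] in
/-- Close lists have the same length. [folklore] -/
theorem Close.length_eq {α δ : ℝ} {l l' : List 𝔸} (h : Close α δ l l') : l.length = l'.length :=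
  List.Forall₂.length_eq h

omit [NormedAlgebra ℂ 𝔸] in
/-- Sizes of close lists: `size l ≤ n α`. [folklore] -/
theorem Close.size_le {α δ : ℝ} {l l' : List 𝔸} (h : Close α δ l l') : size l ≤ l.length * α := by
  induction h with
  | nil => simp
  | cons hb _ ih => rw [size_cons, List.length_cons, Nat.cast_succ]; linarith [hb.1]

omit [NormedAlgebra ℂ 𝔸] in
/-- Sizes of close lists: `size l' ≤ n α`. [folklore] -/
theorem Close.size_le' {α δ : ℝ} {l l' : List 𝔸} (h : Close α δ l l') : size l' ≤ l.length * α := by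
  induction h with
  | nil => simp
  | cons hb _ ih => rw [size_cons, List.length_cons, Nat.cast_succ]; linarith [hb.2.1]

omit [NormedAlgebra ℂ 𝔸] in
/-- Sums of close lists: `‖Σ l' − Σ l‖ ≤ n δ`. [folklore] -/
theorem Close.norm_sum_sub_le {α δ : ℝ} {l l' : List 𝔸} (h : Close α δ l l') : ‖l'.sum - l.sum‖ ≤ l.length * δ := by
  induction h with
  | nil => simp
  | @cons b b' l l' hb _ ih =>
    rw [List.sum_cons, List.sum_cons, List.length_cons, Nat.cast_succ,
      show b' + l'.sum - (b + l.sum) = (b' - b) + (l'.sum - l.sum) by abel]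
    exact (norm_add_le _ _).trans (by linarith [hb.2.2])

/-- **The quadratic transport vertex is Lipschitz on close lists**: `‖quad l' − quad l‖ ≤ n²·α·δ`. [folklore] -/
theorem Close.norm_quad_sub_le {α δ : ℝ} {l l' : List 𝔸} (h : Close α δ l l') (hα : 0 ≤ α) (hδ : 0 ≤ δ) :
    ‖quad ℂ l' - quad ℂ l‖ ≤ (l.length : ℝ) ^ 2 * α * δ := by
  induction h with
  | nil => simp
  | @cons b b' l l' hb hl ih =>
    obtain ⟨hbα, hb'α, hbb⟩ := hb
    have hS' : ‖l'.sum‖ ≤ l.length * α := (norm_sum_le_size l').trans (Close.size_le' hl)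
    have hD : ‖l'.sum - l.sum‖ ≤ l.length * δ := Close.norm_sum_sub_le hl
    have hn : (0 : ℝ) ≤ l.length := Nat.cast_nonneg _
    rw [quad_cons, quad_cons, List.length_cons, Nat.cast_succ]
    have e1 : quad ℂ l' + b' * l'.sum + (2 : ℂ)⁻¹ • (b' * b') - (quad ℂ l + b * l.sum + (2 : ℂ)⁻¹ • (b * b))
        = (quad ℂ l' - quad ℂ l) + ((b' - b) * l'.sum + b * (l'.sum - l.sum))
          + (2 : ℂ)⁻¹ • ((b' - b) * b' + b * (b' - b)) := by
      rw [smul_add, mul_sub, mul_sub, sub_mul, sub_mul, smul_sub, smul_sub]; abel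
    rw [e1]
    have t2 : ‖(b' - b) * l'.sum + b * (l'.sum - l.sum)‖ ≤ δ * (l.length * α) + α * (l.length * δ) :=
      (norm_add_le _ _).trans (add_le_add ((norm_mul_le _ _).trans (mul_le_mul hbb hS' (norm_nonneg _) hδ))
        ((norm_mul_le _ _).trans (mul_le_mul hbα hD (norm_nonneg _) hα)))
    have t3 : ‖(2 : ℂ)⁻¹ • ((b' - b) * b' + b * (b' - b))‖ ≤ 2⁻¹ * (δ * α + α * δ) := by
      rw [norm_smul, norm_inv, RCLike.norm_ofNat]
      exact mul_le_mul_of_nonneg_left ((norm_add_le _ _).trans (add_le_add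
        ((norm_mul_le _ _).trans (mul_le_mul hbb hb'α (norm_nonneg _) hδ))
        ((norm_mul_le _ _).trans (mul_le_mul hbα hbb (norm_nonneg _) hα)))) (by norm_num)
    calc _ ≤ ‖quad ℂ l' - quad ℂ l‖ + ‖(b' - b) * l'.sum + b * (l'.sum - l.sum)‖
          + ‖(2 : ℂ)⁻¹ • ((b' - b) * b' + b * (b' - b))‖ := norm_add₃_le
      _ ≤ (l.length : ℝ) ^ 2 * α * δ + (δ * (l.length * α) + α * (l.length * δ)) + 2⁻¹ * (δ * α + α * δ) :=
          add_le_add_three ih t2 t3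
      _ = ((l.length : ℝ) + 1) ^ 2 * α * δ := by ring

end Quad

/-- `‖e_κ‖_{ℓ¹} = 1`. [folklore] -/
theorem l1_e (κ : Fin d) : l1 (e κ : Site d) = 1 := by
  have h := l1_vec ((κ, true) : Letter d)
  simpa [Letter.vec] using h

/-- The plaquette lists at `x` and `x + e_κ` are `(α₀, α₁)`-close when the potentials are bounded by `α₀` and their
`κ`-differences by `α₁` at the three corners `x, x + e_μ, x + e_ν`. [folklore] -/
theorem close_plaqList {a : Site d → Fin d → 𝕄} {x : Site d} {κ μ ν : Fin d} {α₀ α₁ : ℝ}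
    (h0 : ∀ y τ, l1 (y - x) ≤ 2 → ‖a y τ‖ ≤ α₀)
    (h1 : ∀ y τ, l1 (y - x) ≤ 1 → ‖fd κ (fun z => a z τ) y‖ ≤ α₁) :
    Close α₀ α₁ (plaqList a x μ ν) (plaqList a (x + e κ) μ ν) := by
  have hx : l1 (x - x) ≤ 1 := by simp [l1]
  have hx2 : l1 (x - x) ≤ 2 := by simp [l1]
  have hμ : l1 (x + e μ - x) ≤ 1 := by rw [add_sub_cancel_left, l1_e]
  have hν : l1 (x + e ν - x) ≤ 1 := by rw [add_sub_cancel_left, l1_e]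
  have hκ2 : l1 (x + e κ - x) ≤ 2 := by rw [add_sub_cancel_left, l1_e]; omega
  have hκμ : l1 (x + e κ + e μ - x) ≤ 2 := by
    rw [show x + e κ + e μ - x = e κ + e μ by abel]; exact (l1_add_le _ _).trans (by rw [l1_e, l1_e])
  have hκν : l1 (x + e κ + e ν - x) ≤ 2 := by
    rw [show x + e κ + e ν - x = e κ + e ν by abel]; exact (l1_add_le _ _).trans (by rw [l1_e, l1_e])
  have hμ2 : l1 (x + e μ - x) ≤ 2 := hμ.trans (by norm_num)
  have hν2 : l1 (x + e ν - x) ≤ 2 := hν.trans (by norm_num)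
  refine List.Forall₂.cons ⟨h0 _ _ hx2, h0 _ _ hκ2, by simpa [fd] using h1 x μ hx⟩
    (List.Forall₂.cons ⟨h0 _ _ hμ2, h0 _ _ hκμ, ?_⟩
    (List.Forall₂.cons ⟨by rw [norm_neg]; exact h0 _ _ hν2, by rw [norm_neg]; exact h0 _ _ hκν, ?_⟩
    (List.Forall₂.cons ⟨by rw [norm_neg]; exact h0 _ _ hx2, by rw [norm_neg]; exact h0 _ _ hκ2, ?_⟩
    List.Forall₂.nil)))
  · have := h1 (x + e μ) ν hμ; simp only [fd] at this; rwa [add_right_comm x (e κ) (e μ)]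
  · have := h1 (x + e ν) μ hν; simp only [fd] at this
    rw [add_right_comm x (e κ) (e ν), show -a (x + e ν + e κ) μ - -a (x + e ν) μ
      = -(a (x + e ν + e κ) μ - a (x + e ν) μ) by abel, norm_neg]; exact this
  · have := h1 x ν hx; simp only [fd] at this
    rw [show -a (x + e κ) ν - -a x ν = -(a (x + e κ) ν - a x ν) by abel, norm_neg]; exact this

end

end Summit.QuantumFields.BalabanUV.T4Continuum.AveragingDeficitPlaqList
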